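import Summits.Ventures.PercRepro.Night2ShapeOneSideKF

/-!
# PercRepro — the seven-point shape (i): THE TWO-SIDED FINITE CHECK in the thin-`H` regimes (night-2, gen 30)

With `r_H ≤ 7/30` the capacity `11/18 − r_H` is at least `17/45 = 272/720`.  **No fat face** (`shapeOne_couplingNF`):
each side loads at most `100/720` (NF1).  **One fat `K`-face** (`shapeOne_couplingKF`, the fat face being the face `1`
of side `1`): the fat side loads at most `244/720` (KF1), and then every point off `H` is visible on side `2`; with two
such points and a free `E`-point on side `2` (the floor `|Out| ≥ 4`) side `2` loads at most `27/720` (NF3′): `271/720`;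
with three or more, `r_H ≤ 7/36`, the fat side loads at most `174/720` and side `2` at most `36/720` against a
capacity `≥ 300/720`; with a visible `Z`-point on the fat side, or two or more points attached to the fat face, the fat
side loads at most `138/720` / `159/720` against side `2`'s `100/720` (proofs/NIGHT-2-g30.md §4.2–§4.3).
-/

namespace PercRepro.Shadow

section Coupling

variable {e1o e2o eb eb01 eb02 nZ : ℕ} {rH : ℚ}
variable {fE₁ a₁ a₂ a₃ zf₁ z₁ z₂ z₃ s₁ s₂ s₃ g₁ g₂ g₃ : ℕ} {r₁ r₂ r₃ : ℚ}
variable {fE₂ b₁ b₂ b₃ zf₂ y₁ y₂ y₃ t₁ t₂ t₃ h₁ h₂ h₃ : ℕ} {u₁ u₂ u₃ : ℚ}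

/-- **The no-fat coupling**: with `r_H ≤ 7/30` and no fat face, the six losses sum to at most `200/720 ≤ 11/18 − r_H`. -/
theorem shapeOne_couplingNF (hH : rH ≤ 7 / 30)
    (hs₁ : s₁ = fE₁ + zf₁ + (a₂ + z₂) + (a₃ + z₃)) (hs₂ : s₂ = fE₁ + zf₁ + (a₁ + z₁) + (a₃ + z₃))
    (hs₃ : s₃ = fE₁ + zf₁ + (a₁ + z₁) + (a₂ + z₂))
    (hg₁ : g₁ = 1 + fE₁ + a₁ + zf₁ + (z₁ + z₂ + z₃)) (hg₂ : g₂ = 1 + fE₁ + a₂ + zf₁ + (z₁ + z₂ + z₃))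
    (hg₃ : g₃ = 1 + fE₁ + a₃ + zf₁ + (z₁ + z₂ + z₃))
    (hr₁ : r₁ ≤ rhoReq (2 + s₁)) (h₁0 : s₁ = 0 → r₁ = 0) (hr₂ : r₂ ≤ rhoReq (2 + s₂)) (h₂0 : s₂ = 0 → r₂ = 0)
    (hr₃ : r₃ ≤ rhoReq (2 + s₃)) (h₃0 : s₃ = 0 → r₃ = 0)
    (ht₁ : t₁ = fE₂ + zf₂ + (b₂ + y₂) + (b₃ + y₃)) (ht₂ : t₂ = fE₂ + zf₂ + (b₁ + y₁) + (b₃ + y₃))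
    (ht₃ : t₃ = fE₂ + zf₂ + (b₁ + y₁) + (b₂ + y₂))
    (hh₁ : h₁ = 1 + fE₂ + b₁ + zf₂ + (y₁ + y₂ + y₃)) (hh₂ : h₂ = 1 + fE₂ + b₂ + zf₂ + (y₁ + y₂ + y₃))
    (hh₃ : h₃ = 1 + fE₂ + b₃ + zf₂ + (y₁ + y₂ + y₃))
    (hu₁ : u₁ ≤ rhoReq (2 + t₁)) (hu₁0 : t₁ = 0 → u₁ = 0) (hu₂ : u₂ ≤ rhoReq (2 + t₂)) (hu₂0 : t₂ = 0 → u₂ = 0)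
    (hu₃ : u₃ ≤ rhoReq (2 + t₃)) (hu₃0 : t₃ = 0 → u₃ = 0) :
    (max (rH + r₂ + r₃ - 11 / 18) 0 / (g₁ : ℚ) + max (rH + r₁ + r₃ - 11 / 18) 0 / (g₂ : ℚ) +
      max (rH + r₁ + r₂ - 11 / 18) 0 / (g₃ : ℚ)) +
    (max (rH + u₂ + u₃ - 11 / 18) 0 / (h₁ : ℚ) + max (rH + u₁ + u₃ - 11 / 18) 0 / (h₂ : ℚ) +
      max (rH + u₁ + u₂ - 11 / 18) 0 / (h₃ : ℚ)) ≤ 200 / 720 := by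
  obtain ⟨hL₁, hB₁, hn₁⟩ := lossNF_props hH hr₂ h₂0 hr₃ h₃0
  obtain ⟨hL₂, hB₂, hn₂⟩ := lossNF_props hH hr₁ h₁0 hr₃ h₃0
  obtain ⟨hL₃, hB₃, hn₃⟩ := lossNF_props hH hr₁ h₁0 hr₂ h₂0
  obtain ⟨hM₁, hC₁, hm₁⟩ := lossNF_props hH hu₂ hu₂0 hu₃ hu₃0
  obtain ⟨hM₂, hC₂, hm₂⟩ := lossNF_props hH hu₁ hu₁0 hu₃ hu₃0
  obtain ⟨hM₃, hC₃, hm₃⟩ := lossNF_props hH hu₁ hu₁0 hu₂ hu₂0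
  have S1 := sideNF_core_P1 hs₁ hs₂ hs₃ hg₁ hg₂ hg₃ hL₁ hB₁ hn₁ hL₂ hB₂ hn₂ hL₃ hB₃ hn₃
  have S2 := sideNF_core_P1 ht₁ ht₂ ht₃ hh₁ hh₂ hh₃ hM₁ hC₁ hm₁ hM₂ hC₂ hm₂ hM₃ hC₃ hm₃
  linarith

set_option maxHeartbeats 800000 in
/-- **The K-fat coupling** (the fat face is the face `1` of side `1`: `s₁ = 0`, request `7/24`): the six losses sum to
at most `11/18 − r_H`, under the floor `|E| + |Z| ≥ 4`, every `Z`-point visible on a side, and `r_H` admissible for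
`m_H = 1 + |Z|` (`r_H ≤ 7/30`; `≤ 7/36` when `|Z| ≥ 3`; `0` when `|Z| ≤ 1`). -/
theorem shapeOne_couplingKF (hH : rH ≤ 7 / 30) (hH36 : 3 ≤ nZ → rH ≤ 7 / 36) (hH0 : nZ ≤ 1 → rH = 0)
    (hOut : 4 ≤ e1o + e2o + eb + nZ) (hfE₁ : fE₁ = e1o + eb01) (hab : eb = eb01 + (a₁ + a₂ + a₃))
    (hfE₂ : fE₂ = e2o + eb02) (hbb : eb = eb02 + (b₁ + b₂ + b₃))
    (hζ : nZ ≤ zf₁ + (z₁ + z₂ + z₃) + (zf₂ + (y₁ + y₂ + y₃)))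
    (hs₁ : s₁ = fE₁ + zf₁ + (a₂ + z₂) + (a₃ + z₃)) (hs₂ : s₂ = fE₁ + zf₁ + (a₁ + z₁) + (a₃ + z₃))
    (hs₃ : s₃ = fE₁ + zf₁ + (a₁ + z₁) + (a₂ + z₂))
    (hg₁ : g₁ = 1 + fE₁ + a₁ + zf₁ + (z₁ + z₂ + z₃)) (hg₂ : g₂ = 1 + fE₁ + a₂ + zf₁ + (z₁ + z₂ + z₃))
    (hg₃ : g₃ = 1 + fE₁ + a₃ + zf₁ + (z₁ + z₂ + z₃))
    (hfat : s₁ = 0) (hr₂ : r₂ ≤ rhoReq (2 + s₂)) (h₂0 : s₂ = 0 → r₂ = 0) (hr₃ : r₃ ≤ rhoReq (2 + s₃))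
    (h₃0 : s₃ = 0 → r₃ = 0)
    (ht₁ : t₁ = fE₂ + zf₂ + (b₂ + y₂) + (b₃ + y₃)) (ht₂ : t₂ = fE₂ + zf₂ + (b₁ + y₁) + (b₃ + y₃))
    (ht₃ : t₃ = fE₂ + zf₂ + (b₁ + y₁) + (b₂ + y₂))
    (hh₁ : h₁ = 1 + fE₂ + b₁ + zf₂ + (y₁ + y₂ + y₃)) (hh₂ : h₂ = 1 + fE₂ + b₂ + zf₂ + (y₁ + y₂ + y₃))
    (hh₃ : h₃ = 1 + fE₂ + b₃ + zf₂ + (y₁ + y₂ + y₃))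
    (hu₁ : u₁ ≤ rhoReq (2 + t₁)) (hu₁0 : t₁ = 0 → u₁ = 0) (hu₂ : u₂ ≤ rhoReq (2 + t₂)) (hu₂0 : t₂ = 0 → u₂ = 0)
    (hu₃ : u₃ ≤ rhoReq (2 + t₃)) (hu₃0 : t₃ = 0 → u₃ = 0) :
    (max (rH + r₂ + r₃ - 11 / 18) 0 / (g₁ : ℚ) + max (rH + 7 / 24 + r₃ - 11 / 18) 0 / (g₂ : ℚ) +
      max (rH + 7 / 24 + r₂ - 11 / 18) 0 / (g₃ : ℚ)) +
    (max (rH + u₂ + u₃ - 11 / 18) 0 / (h₁ : ℚ) + max (rH + u₁ + u₃ - 11 / 18) 0 / (h₂ : ℚ) +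
      max (rH + u₁ + u₂ - 11 / 18) 0 / (h₃ : ℚ)) ≤ 11 / 18 - rH := by
  obtain ⟨hM₁, hC₁, hm₁⟩ := lossNF_props hH hu₂ hu₂0 hu₃ hu₃0
  obtain ⟨hM₂, hC₂, hm₂⟩ := lossNF_props hH hu₁ hu₁0 hu₃ hu₃0
  obtain ⟨hM₃, hC₃, hm₃⟩ := lossNF_props hH hu₁ hu₁0 hu₂ hu₂0
  have S2 := sideNF_core_P1 ht₁ ht₂ ht₃ hh₁ hh₂ hh₃ hM₁ hC₁ hm₁ hM₂ hC₂ hm₂ hM₃ hC₃ hm₃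
  obtain ⟨K1, K2, K3, K0⟩ := sideKF_le hs₁ hs₂ hs₃ hg₁ hg₂ hg₃ hfat hr₂ h₂0 hr₃ h₃0 hH
  -- the fat face is null: no free point on side `1`, nothing attached to `2` or `3`
  have hfE₁0 : fE₁ = 0 := by omega
  have hzf₁0 : zf₁ = 0 := by omega
  have hz₂ : z₂ = 0 := by omega
  have hz₃ : z₃ = 0 := by omega
  rcases Nat.eq_zero_or_pos (a₁ + z₁) with hN0 | hN
  · have := K0 hN0; linarith
  rcases Nat.lt_or_ge (a₁ + z₁) 2 with hN1 | hN2
  swap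
  · have := K3 hN2; linarith
  rcases Nat.eq_zero_or_pos z₁ with hz₁ | hz₁
  swap
  · have := K2 hz₁; linarith
  -- `N = 1`, the point is an `E`-point attached to the fat face; every `Z`-point is visible on side `2`
  have ha₁ : a₁ = 1 := by omega
  have hζ₂ : nZ ≤ zf₂ + (y₁ + y₂ + y₃) := by omega
  rcases Nat.lt_or_ge nZ 2 with hnZ | hnZ
  · -- `|Z| ≤ 1`: `r_H = 0`, capacity `11/18`
    have h0 := hH0 (by omega)
    have hcap : (440 : ℚ) / 720 ≤ 11 / 18 - rH := by rw [h0]; norm_num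
    linarith
  rcases Nat.lt_or_ge nZ 3 with hnZ2 | hnZ3
  · -- `|Z| = 2`: a free `E`-point on side `2` (the floor), NF3′
    have he2o : 1 ≤ e2o := by omega
    have S2' := sideNF_le_zeta2_fE1 ht₁ ht₂ ht₃ hh₁ hh₂ hh₃ hu₁ hu₁0 hu₂ hu₂0 hu₃ hu₃0 hH (by omega) (by omega)
    linarith
  · -- `|Z| ≥ 3`: `r_H ≤ 7/36`
    have hH' := hH36 hnZ3
    have K4 := sideKF_le_rH36 hs₁ hs₂ hs₃ hg₁ hg₂ hg₃ hfat hr₂ h₂0 hr₃ h₃0 hH'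
    have S2' := sideNF_le_zeta2_rH36 hh₁ hh₂ hh₃ hu₁ hu₁0 hu₂ hu₂0 hu₃ hu₃0 hH' (by omega)
    linarith

end Coupling

end PercRepro.Shadow
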